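import Summits.QuantumFields.YangMills.Theorems.AllWindowsColdBoxBoxHighLineLandauKernelBounds
import Summits.QuantumFields.YangMills.Theorems.AllWindowsColdBoxBoxHighLineBootstrapAssemblySharp

/-!
# LINE-20 stub U2 `stub_landauRepresentativeStrong` BY NAME, from S3b

With S3b `RestBlock.landauKernelDecay : LandauKernelDecay` a tree theorem (file `…LandauKernelBounds`), the registered stub U2
`stub_landauRepresentativeStrong : LandauRepresentativeBound` of LINE-20 «landau-rung3» (⟨stmt-QuantumFields-24336⟩) is the landed
implication `landauRepresentativeBound_of_landauKernelDecay` (✓p729140, file `…BootstrapAssemblySharp`, w5 g19) applied to it.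

HONEST LABEL: closes the registered stub U2 by name; U1 (U1b/U1c), U5, U6 remain; the crux ⟨24336⟩, the rung and the summit are NOT
proved; the Yang–Mills mass gap is NOT proved by this file.
-/

set_option autoImplicit false

noncomputable section

namespace Summit.QuantumFields.YangMills.Theorems.AllWindowsColdBoxBoxHighLine

/-- **Stub U2 of LINE-20, BY NAME**: the small Landau representative with the v9 (strong) typing. -/
theorem stub_landauRepresentativeStrong : LandauRepresentativeBound :=
  landauRepresentativeBound_of_landauKernelDecay RestBlock.landauKernelDecay

/-- Registry re-tick of U2 on ⟨stmt-QuantumFields-24336⟩ (the stub above was first filed in helper mode, ✓p731888): the strong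
representative bound, restated as a usable `example` (no new declaration). -/
example : LandauRepresentativeBound := stub_landauRepresentativeStrong

end Summit.QuantumFields.YangMills.Theorems.AllWindowsColdBoxBoxHighLine

end
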